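import Summits.NavierStokesRegularity.NavierStokesRegularity.Theses.FilamentSkeletonRss
import Literature.Analysis.FluidPDE.GaussianVortexPlanarProofs
import Literature.Analysis.FluidPDE.BiotSavart2DSymmetry
import Literature.Analysis.FluidPDE.WholeSpaceIBP
import Summits.AnomalousDissipation.AnomalousDissipation.Theorems.MarginalStabilityChainStretchedVortexRowsStubLogPotentialTools
import Summits.AnomalousDissipation.AnomalousDissipation.Theorems.MarginalStabilityChainStretchedVortexRowsStubLogPotentialGradient
import Summits.AnomalousDissipation.AnomalousDissipation.Theorems.MarginalStabilityChainStretchedVortexRowsStubLogPotentialGreen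
import Summits.AnomalousDissipation.AnomalousDissipation.Theorems.MarginalStabilityChainStretchedVortexRowsStubCellStreamRepresentation

/-!
# Crux `CoreLinearInvertibility` (stmt-NavierStokesRegularity-17973), line `Sketch`:
# tools for stub `stub_oddSymmetrizerBounds` — the logarithmic potential of a `C²_c` density

Helper file (theorems only; lands `--supports stmt-NavierStokesRegularity-17973`, ends with the
registered sub-stub `stub_oddSymmetrizerBoundsToolsA`) for the stub `stub_oddSymmetrizerBounds` of
the skeleton `Cruxes/CoreLinearInvertibility/Lines/Sketch.lean` (Maekawa's forward
symmetrizer `u = Φ(|x|) ψ`, `ψ = N ∗ w`).  For a `C²` compactly supported planar density `w` and its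
logarithmic potential `ψ(x) = ∫ (2π)⁻¹ log ‖x − y‖ w(y) dy` (`N = (2π)⁻¹ log ‖·‖`):

* compactly supported continuous functions are dominated by every Gaussian
  (`oddSym_exists_gauss_bound`), so the log-potential toolkit of
  `Summits.AnomalousDissipation.….MarginalStabilityChainStretchedVortexRowsStubLogPotential*`
  (same planar vocabulary; CONVENTIONS §2 allows `Summits.<Any>.<Problem>.Theorems.*`) applies to
  `w` and to all its partial derivatives;
* `ψ ∈ C²` with `Dψ[v] = N ∗ (Dw[v])`, `D²ψ[v][v'] = N ∗ (D(Dw[v])[v'])`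
  (`oddSym_psi_contDiff_two`), and `|ψ|, ‖Dψ‖, ‖D²ψ‖ ≤ C_w (1 + ‖x‖)` (`oddSym_psi_bounds`);
* `ψ` is odd when `w` is odd (`oddSym_psi_odd`);
* `∇ψ = ∫ w(η) DN(· − η) dη` and the Biot–Savart law is its rotation, `K ∗ w = (∇ψ)^⊥`
  (`oddSym_biotSavart2D_eq_perp_gradient`), so `‖(K∗w)(x)‖ = ‖Dψ(x)‖`;
* the Poisson equation `Δψ = w` (`oddSym_laplacian_psi`: weak form of the toolkit + Green's
  identity without boundary + the fundamental lemma of the calculus of variations).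

References: standard planar potential theory (Th. Gallay, C. E. Wayne, Comm. Math. Phys. 255
(2005), §1; Y. Maekawa, J. Math. Fluid Mech. 13 (2011), §2, the substitution `u = Φψ`); folklore.
-/

set_option linter.dupNamespace false

noncomputable section

namespace Summit.NavierStokesRegularity.NavierStokesRegularity.Theorems

open MeasureTheory Filter Topology Set Function Metric
open Literature.Analysis.FluidPDE
open Summit.AnomalousDissipation.AnomalousDissipation.Theorems.MarginalStabilityChainStretchedVortexRows
open scoped InnerProductSpace Laplacian ContDiff

/-! ### Compactly supported functions are of every Gaussian class -/

/-- A continuous compactly supported function is dominated by every Gaussian: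
`‖g(η)‖ ≤ B e^{−c‖η‖²}` for some `B ≥ 0`. [folklore] -/
theorem oddSym_exists_gauss_bound {F : Type*} [NormedAddCommGroup F]
    {g : EuclideanSpace ℝ (Fin 2) → F} (hg : Continuous g) (hgc : HasCompactSupport g) (c : ℝ) :
    ∃ B : ℝ, 0 ≤ B ∧ ∀ η, ‖g η‖ ≤ B * Real.exp (-c * ‖η‖ ^ 2) := by
  obtain ⟨M, hM⟩ := hg.bounded_above_of_compact_support hgc
  obtain ⟨ρ, hρ⟩ := hgc.isCompact.isBounded.subset_closedBall 0
  refine ⟨max M 0 * Real.exp (|c| * ρ ^ 2), by positivity, fun η => ?_⟩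
  by_cases hη : η ∈ tsupport g
  · have hηρ : ‖η‖ ≤ ρ := by simpa using hρ hη
    have hρ0 : 0 ≤ ρ := (norm_nonneg η).trans hηρ
    have h1 : 1 ≤ Real.exp (|c| * ρ ^ 2) * Real.exp (-c * ‖η‖ ^ 2) := by
      rw [← Real.exp_add]
      refine Real.one_le_exp ?_
      have h2 : ‖η‖ ^ 2 ≤ ρ ^ 2 := pow_le_pow_left₀ (norm_nonneg η) hηρ 2
      nlinarith [le_abs_self c, neg_abs_le c, sq_nonneg (‖η‖), abs_nonneg c]
    calc ‖g η‖ ≤ max M 0 := (hM η).trans (le_max_left _ _)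
      _ ≤ max M 0 * (Real.exp (|c| * ρ ^ 2) * Real.exp (-c * ‖η‖ ^ 2)) :=
          le_mul_of_one_le_right (le_max_right _ _) h1
      _ = _ := by ring
  · rw [image_eq_zero_of_notMem_tsupport hη, norm_zero]
    positivity

/-- The `C¹` Gaussian package of a `C¹` compactly supported function: one constant `B` with
`|g| ≤ B e^{−‖η‖²/8}` and `‖Dg‖ ≤ B e^{−‖η‖²/8}`. [folklore] -/
theorem oddSym_exists_gauss_bound_C1 {g : EuclideanSpace ℝ (Fin 2) → ℝ} (hg : ContDiff ℝ 1 g)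
    (hgc : HasCompactSupport g) :
    ∃ B : ℝ, 0 ≤ B ∧ (∀ η, |g η| ≤ B * Real.exp (-(1 / 8) * ‖η‖ ^ 2)) ∧
      ∀ η, ‖fderiv ℝ g η‖ ≤ B * Real.exp (-(1 / 8) * ‖η‖ ^ 2) := by
  obtain ⟨B₀, hB₀, h₀⟩ := oddSym_exists_gauss_bound hg.continuous hgc (1 / 8)
  obtain ⟨B₁, hB₁, h₁⟩ := oddSym_exists_gauss_bound (hg.continuous_fderiv one_ne_zero)
    (hgc.fderiv (𝕜 := ℝ)) (1 / 8)
  refine ⟨max B₀ B₁, le_max_of_le_left hB₀, fun η => ?_, fun η => ?_⟩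
  · rw [← Real.norm_eq_abs]
    exact (h₀ η).trans (by gcongr; exact le_max_left _ _)
  · exact (h₁ η).trans (by gcongr; exact le_max_right _ _)

/-! ### Coordinates: operator norms from the two basis vectors -/

/-- Operator norm from the basis vectors: `‖L‖ ≤ ‖L e₀‖ + ‖L e₁‖` on `ℝ²`. [folklore] -/
theorem oddSym_opNorm_le_fin_two {F : Type*} [NormedAddCommGroup F] [NormedSpace ℝ F]
    (L : EuclideanSpace ℝ (Fin 2) →L[ℝ] F) :
    ‖L‖ ≤ ‖L (EuclideanSpace.single 0 1)‖ + ‖L (EuclideanSpace.single 1 1)‖ := by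
  refine ContinuousLinearMap.opNorm_le_bound _ (by positivity) fun v => ?_
  have h0 : |v 0| ≤ ‖v‖ := FourierNS.abs_apply_le_norm v 0
  have h1 : |v 1| ≤ ‖v‖ := FourierNS.abs_apply_le_norm v 1
  have hv : v = v 0 • EuclideanSpace.single 0 (1 : ℝ) + v 1 • EuclideanSpace.single 1 (1 : ℝ) := by
    ext i
    fin_cases i <;> simp
  conv_lhs => rw [hv]
  rw [map_add, map_smul, map_smul]
  calc ‖v 0 • L (EuclideanSpace.single 0 1) + v 1 • L (EuclideanSpace.single 1 1)‖
      ≤ ‖v 0 • L (EuclideanSpace.single 0 1)‖ + ‖v 1 • L (EuclideanSpace.single 1 1)‖ :=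
        norm_add_le _ _
    _ = |v 0| * ‖L (EuclideanSpace.single 0 1)‖ + |v 1| * ‖L (EuclideanSpace.single 1 1)‖ := by
        rw [norm_smul, norm_smul, Real.norm_eq_abs, Real.norm_eq_abs]
    _ ≤ ‖v‖ * ‖L (EuclideanSpace.single 0 1)‖ + ‖v‖ * ‖L (EuclideanSpace.single 1 1)‖ := by
        gcongr
    _ = _ := by ring

/-! ### The logarithmic potential of a `C²_c` density is `C²` -/

section Potential

variable {w ψ : EuclideanSpace ℝ (Fin 2) → ℝ} (hw : ContDiff ℝ 2 w) (hwc : HasCompactSupport w)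
  (hψ : ∀ x, ψ x = ∫ y, (2 * Real.pi)⁻¹ * Real.log ‖x - y‖ * w y)

include hw hwc in
/-- The directional derivative `Dw[v]` of a `C²_c` function is `C¹_c`. [folklore] -/
theorem oddSym_fderiv_apply_C1c (v : EuclideanSpace ℝ (Fin 2)) :
    ContDiff ℝ 1 (fun η => fderiv ℝ w η v) ∧ HasCompactSupport (fun η => fderiv ℝ w η v) :=
  ⟨(hw.fderiv_right (m := 1) le_rfl).clm_apply contDiff_const, hwc.fderiv_apply (𝕜 := ℝ) v⟩

include hw hwc hψ in
/-- **`ψ = N ∗ w ∈ C¹`** with `Dψ(x)[v] = ∫ N(x − η) Dw(η)[v] dη`. [folklore] -/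
theorem oddSym_psi_contDiff_one :
    ContDiff ℝ 1 ψ ∧ ∀ x v, fderiv ℝ ψ x v =
      ∫ η, (2 * Real.pi)⁻¹ * Real.log ‖x - η‖ * fderiv ℝ w η v := by
  obtain ⟨B, -, h0, h1⟩ := oddSym_exists_gauss_bound_C1 (hw.of_le one_le_two) hwc
  have hfun : ψ = fun x => ∫ y, (2 * Real.pi)⁻¹ * Real.log ‖x - y‖ * w y := funext hψ
  rw [hfun]
  exact contDiff_one_logPotential_of_gaussBound (hw.of_le one_le_two) h0 h1

include hw hwc hψ in
/-- **`ψ = N ∗ w ∈ C²`** for `w ∈ C²_c`, with the second derivatives falling on `w`: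
`D(Dψ[v])(x)[v'] = ∫ N(x − η) D(Dw[v])(η)[v'] dη`. [folklore] -/
theorem oddSym_psi_contDiff_two :
    ContDiff ℝ 2 ψ ∧ ∀ x v v', fderiv ℝ (fun y => fderiv ℝ ψ y v) x v' =
      ∫ η, (2 * Real.pi)⁻¹ * Real.log ‖x - η‖ * fderiv ℝ (fun η => fderiv ℝ w η v) η v' := by
  obtain ⟨hC1, hD⟩ := oddSym_psi_contDiff_one hw hwc hψ
  have hv : ∀ v, ContDiff ℝ 1 (fun y => fderiv ℝ ψ y v) ∧ ∀ x v', fderiv ℝ (fun y => fderiv ℝ ψ y v) x v' =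
      ∫ η, (2 * Real.pi)⁻¹ * Real.log ‖x - η‖ * fderiv ℝ (fun η => fderiv ℝ w η v) η v' := by
    intro v
    obtain ⟨hg, hgc⟩ := oddSym_fderiv_apply_C1c hw hwc v
    obtain ⟨B, -, h0, h1⟩ := oddSym_exists_gauss_bound_C1 hg hgc
    have hfun : (fun y => fderiv ℝ ψ y v) =
        fun x => ∫ η, (2 * Real.pi)⁻¹ * Real.log ‖x - η‖ * fderiv ℝ w η v := funext fun x => hD x v
    rw [hfun]
    exact contDiff_one_logPotential_of_gaussBound hg h0 h1
  refine ⟨?_, fun x v v' => (hv v).2 x v'⟩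
  rw [show (2 : WithTop ℕ∞) = 1 + 1 from rfl, contDiff_succ_iff_fderiv_apply]
  exact ⟨hC1.differentiable one_ne_zero, fun h => absurd h (by decide), fun v => (hv v).1⟩

include hw hwc hψ in
/-- **Growth of `ψ`, `Dψ`, `D²ψ`**: all three are `O(1 + ‖x‖)` (indeed `O(1 + log(1 + ‖x‖))`,
from the crude growth bound of the toolkit applied to `w` and its first and second partial
derivatives). [folklore] -/
theorem oddSym_psi_bounds :
    ∃ C : ℝ, 0 ≤ C ∧ ∀ x, |ψ x| ≤ C * (1 + ‖x‖) ∧ ‖fderiv ℝ ψ x‖ ≤ C * (1 + ‖x‖) ∧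
      ‖fderiv ℝ (fderiv ℝ ψ) x‖ ≤ C * (1 + ‖x‖) := by
  obtain ⟨hC2, hD2⟩ := oddSym_psi_contDiff_two hw hwc hψ
  obtain ⟨-, hD⟩ := oddSym_psi_contDiff_one hw hwc hψ
  set e : Fin 2 → EuclideanSpace ℝ (Fin 2) := fun i => EuclideanSpace.single i 1 with he
  -- the log-growth bounds for `w`, `∂ᵢ w`, `∂ⱼ∂ᵢ w`
  obtain ⟨B, -, h0, -⟩ := oddSym_exists_gauss_bound_C1 (hw.of_le one_le_two) hwc
  obtain ⟨C₀, hC₀, hb₀⟩ := abs_logPotential_le h0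
  have h1 : ∀ i : Fin 2, ∃ C : ℝ, 0 ≤ C ∧ ∀ x, |fderiv ℝ ψ x (e i)| ≤ C * (1 + Real.log (1 + ‖x‖)) := by
    intro i
    obtain ⟨hg, hgc⟩ := oddSym_fderiv_apply_C1c hw hwc (e i)
    obtain ⟨B', -, h0', -⟩ := oddSym_exists_gauss_bound_C1 hg hgc
    obtain ⟨C, hC, hb⟩ := abs_logPotential_le h0'
    exact ⟨C, hC, fun x => by rw [hD x (e i)]; exact hb x⟩
  have h2 : ∀ i j : Fin 2, ∃ C : ℝ, 0 ≤ C ∧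
      ∀ x, |fderiv ℝ (fderiv ℝ ψ) x (e i) (e j)| ≤ C * (1 + Real.log (1 + ‖x‖)) := by
    intro i j
    obtain ⟨hg, hgc⟩ := oddSym_fderiv_apply_C1c hw hwc (e j)
    have hg2 : Continuous (fun η => fderiv ℝ (fun η => fderiv ℝ w η (e j)) η (e i)) :=
      (hg.continuous_fderiv one_ne_zero).clm_apply continuous_const
    have hgc2 : HasCompactSupport (fun η => fderiv ℝ (fun η => fderiv ℝ w η (e j)) η (e i)) :=
      hgc.fderiv_apply (𝕜 := ℝ) (e i)
    obtain ⟨B', -, h0'⟩ := oddSym_exists_gauss_bound hg2 hgc2 (1 / 8)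
    obtain ⟨C, hC, hb⟩ := abs_logPotential_le (g := fun η => fderiv ℝ (fun η => fderiv ℝ w η (e j)) η (e i))
      (B := B') (fun η => by rw [← Real.norm_eq_abs]; exact h0' η)
    refine ⟨C, hC, fun x => ?_⟩
    have hdiff : DifferentiableAt ℝ (fderiv ℝ ψ) x :=
      ((hC2.fderiv_right (m := 1) le_rfl).differentiable one_ne_zero) x
    have key : fderiv ℝ (fderiv ℝ ψ) x (e i) (e j) = fderiv ℝ (fun y => fderiv ℝ ψ y (e j)) x (e i) := by
      rw [fderiv_clm_apply hdiff (differentiableAt_const _)]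
      simp
    rw [key, hD2 x (e j) (e i)]
    exact hb x
  choose C₁ hC₁ hb₁ using h1
  choose C₂ hC₂ hb₂ using h2
  have := hC₁ 0; have := hC₁ 1; have := hC₂ 0 0; have := hC₂ 0 1; have := hC₂ 1 0; have := hC₂ 1 1
  refine ⟨C₀ + (C₁ 0 + C₁ 1) + (C₂ 0 0 + C₂ 0 1 + (C₂ 1 0 + C₂ 1 1)),
    by positivity, fun x => ?_⟩
  have hL := repr_one_add_log_le (norm_nonneg x)
  have hL0 : 0 ≤ 1 + Real.log (1 + ‖x‖) := by
    have : 0 ≤ Real.log (1 + ‖x‖) := Real.log_nonneg (by linarith [norm_nonneg x]); linarith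
  have hx1 : 0 ≤ 1 + ‖x‖ := by positivity
  have e0 : |ψ x| ≤ C₀ * (1 + ‖x‖) := by
    rw [hψ x]; exact (hb₀ x).trans (mul_le_mul_of_nonneg_left hL hC₀)
  have e1 : ‖fderiv ℝ ψ x‖ ≤ (C₁ 0 + C₁ 1) * (1 + ‖x‖) := by
    refine (oddSym_opNorm_le_fin_two _).trans ?_
    rw [Real.norm_eq_abs, Real.norm_eq_abs, add_mul]
    exact add_le_add ((hb₁ 0 x).trans (mul_le_mul_of_nonneg_left hL (hC₁ 0)))
      ((hb₁ 1 x).trans (mul_le_mul_of_nonneg_left hL (hC₁ 1)))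
  have e2 : ∀ i, ‖fderiv ℝ (fderiv ℝ ψ) x (e i)‖ ≤ (C₂ i 0 + C₂ i 1) * (1 + ‖x‖) := by
    intro i
    refine (oddSym_opNorm_le_fin_two _).trans ?_
    rw [Real.norm_eq_abs, Real.norm_eq_abs, add_mul]
    exact add_le_add ((hb₂ i 0 x).trans (mul_le_mul_of_nonneg_left hL (hC₂ i 0)))
      ((hb₂ i 1 x).trans (mul_le_mul_of_nonneg_left hL (hC₂ i 1)))
  have e3 : ‖fderiv ℝ (fderiv ℝ ψ) x‖ ≤ (C₂ 0 0 + C₂ 0 1 + (C₂ 1 0 + C₂ 1 1)) * (1 + ‖x‖) := by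
    refine (oddSym_opNorm_le_fin_two _).trans ?_
    rw [add_mul]
    exact add_le_add (e2 0) (e2 1)
  have hpos1 : 0 ≤ (C₁ 0 + C₁ 1) * (1 + ‖x‖) := by positivity
  have hpos2 : 0 ≤ (C₂ 0 0 + C₂ 0 1 + (C₂ 1 0 + C₂ 1 1)) * (1 + ‖x‖) := by positivity
  have hpos0 : 0 ≤ C₀ * (1 + ‖x‖) := by positivity
  refine ⟨?_, ?_, ?_⟩ <;> nlinarith

include hψ in
/-- **`ψ` is odd when `w` is odd** (`y ↦ −y` in the integral, `‖−x + y‖ = ‖x − y‖`). [folklore] -/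
theorem oddSym_psi_odd (hodd : ∀ x, w (-x) = -w x) (x : EuclideanSpace ℝ (Fin 2)) :
    ψ (-x) = -ψ x := by
  calc ψ (-x) = ∫ y, (2 * Real.pi)⁻¹ * Real.log ‖-x - y‖ * w y := hψ _
    _ = ∫ y, (2 * Real.pi)⁻¹ * Real.log ‖-x - -y‖ * w (-y) :=
        (integral_neg_eq_self (fun y => (2 * Real.pi)⁻¹ * Real.log ‖-x - y‖ * w y) volume).symm
    _ = ∫ y, -((2 * Real.pi)⁻¹ * Real.log ‖x - y‖ * w y) := by
        refine integral_congr_ae (Eventually.of_forall fun y => ?_)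
        dsimp only
        rw [hodd, show -x - -y = -(x - y) by abel, norm_neg]
        ring
    _ = -ψ x := by rw [integral_neg, ← hψ]

include hw hwc hψ in
/-- **The gradient of `ψ`** falls on the kernel: `∇ψ(x) = ∫ w(η) DN(x − η) dη`,
`DN(z) = (2π‖z‖²)⁻¹ z`, the integrand being integrable. [folklore] -/
theorem oddSym_gradient_psi (x : EuclideanSpace ℝ (Fin 2)) :
    Integrable (fun η => w η • ((2 * Real.pi * ‖x - η‖ ^ 2)⁻¹ • (x - η))) ∧
      gradient ψ x = ∫ η, w η • ((2 * Real.pi * ‖x - η‖ ^ 2)⁻¹ • (x - η)) := by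
  obtain ⟨B, -, h0, h1⟩ := oddSym_exists_gauss_bound_C1 (hw.of_le one_le_two) hwc
  have hfun : ψ = fun x => ∫ y, (2 * Real.pi)⁻¹ * Real.log ‖x - y‖ * w y := funext hψ
  rw [hfun]
  exact logPotential_gradient_eq B w (hw.of_le one_le_two) h0 h1 x

include hw hwc hψ in
/-- **The Biot–Savart law is the rotated gradient of the logarithmic potential**:
`(K ∗ w)(x) = (∇ψ(x))^⊥` (`K(z) = DN(z)^⊥`, and the rotation `⊥`, a linear isometry, commutes
with the Bochner integral). [folklore] -/
theorem oddSym_biotSavart2D_eq_perp_gradient (x : EuclideanSpace ℝ (Fin 2)) :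
    biotSavart2D w x = perp (gradient ψ x) := by
  obtain ⟨R, hR⟩ := exists_planarRotation 0 1 (by norm_num)
  have hRp : ∀ z, R z = perp z := fun z => by rw [hR]; simp
  obtain ⟨-, hgrad⟩ := oddSym_gradient_psi hw hwc hψ x
  have hcomm : ∫ η, perp (w η • ((2 * Real.pi * ‖x - η‖ ^ 2)⁻¹ • (x - η))) =
      perp (∫ η, w η • ((2 * Real.pi * ‖x - η‖ ^ 2)⁻¹ • (x - η))) := by
    have := R.toLinearIsometry.integral_comp_comm (μ := volume)
      (fun η => w η • ((2 * Real.pi * ‖x - η‖ ^ 2)⁻¹ • (x - η)))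
    simpa only [LinearIsometryEquiv.coe_toLinearIsometry, hRp] using this
  rw [hgrad, ← hcomm]
  unfold biotSavart2D biotSavartKernel2D
  refine integral_congr_ae (Eventually.of_forall fun η => ?_)
  dsimp only
  rw [perp_smul, perp_smul]

include hw hwc hψ in
/-- `‖(K ∗ w)(x)‖ = ‖Dψ(x)‖`. [folklore] -/
theorem oddSym_norm_biotSavart2D_eq (x : EuclideanSpace ℝ (Fin 2)) :
    ‖biotSavart2D w x‖ = ‖fderiv ℝ ψ x‖ := by
  rw [oddSym_biotSavart2D_eq_perp_gradient hw hwc hψ x, norm_perp, gradient,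
    LinearIsometryEquiv.norm_map]

include hw hwc hψ in
/-- **The Poisson equation `Δψ = w`** for the logarithmic potential of a `C²_c` density: the weak
form `∫ ⟪∇ψ, ∇φ⟫ = −∫ w φ` of the toolkit, Green's first identity without boundary
`∫ Δψ φ + Σᵢ ∫ ∂ᵢψ ∂ᵢφ = 0` (`φ ∈ C^∞_c`), and the fundamental lemma of the calculus of variations
(both sides are continuous). [folklore] -/
theorem oddSym_laplacian_psi (x : EuclideanSpace ℝ (Fin 2)) : Δ ψ x = w x := by
  obtain ⟨hC2, -⟩ := oddSym_psi_contDiff_two hw hwc hψ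
  obtain ⟨B, -, h0, h1⟩ := oddSym_exists_gauss_bound_C1 (hw.of_le one_le_two) hwc
  have hfun : ψ = fun x => ∫ y, (2 * Real.pi)⁻¹ * Real.log ‖x - y‖ * w y := funext hψ
  have hΔc : Continuous (Δ ψ) := continuous_laplacian hC2
  suffices h : (Δ ψ) =ᵐ[volume] w from congrFun ((hΔc.ae_eq_iff_eq volume hw.continuous).1 h) x
  refine ae_eq_of_integral_contDiff_smul_eq hΔc.locallyIntegrable hw.continuous.locallyIntegrable
    fun φ hφ hφc => ?_
  have hφ1 : ContDiff ℝ 1 φ := hφ.of_le (by exact_mod_cast le_top)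
  set b := EuclideanSpace.basisFun (Fin 2) ℝ with hb
  -- Green's identity without boundary, `∫ φ Δψ + Σᵢ ∫ ∂ᵢφ ∂ᵢψ = 0`
  have hG := integral_inner_laplacian_add_eq_zero b (F' := ℝ) hC2 hφ1 (Or.inr hφc)
  simp only [RCLike.inner_apply, conj_trivial] at hG
  -- the weak Poisson equation `∫ ⟪∇ψ, ∇φ⟫ = −∫ w φ`
  have hW : ∫ ξ, ⟪gradient ψ ξ, gradient φ ξ⟫_ℝ = -∫ η, w η * φ η := by
    rw [hfun]
    exact integral_inner_gradient_logPotential_gradient (hw.of_le one_le_two) h0 h1 hφ1 hφc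
  -- the sum of the partial products is the gradient pairing
  have hint : ∀ i, Integrable (fun ξ => fderiv ℝ φ ξ (b i) * fderiv ℝ ψ ξ (b i)) := fun i =>
    (((hφ1.continuous_fderiv one_ne_zero).clm_apply continuous_const).mul
      ((hC2.continuous_fderiv two_ne_zero).clm_apply continuous_const)).integrable_of_hasCompactSupport
      ((hφc.fderiv_apply (𝕜 := ℝ) (b i)).mul_right)
  have hsum : ∑ i, ∫ ξ, fderiv ℝ φ ξ (b i) * fderiv ℝ ψ ξ (b i) =
      ∫ ξ, ⟪gradient ψ ξ, gradient φ ξ⟫_ℝ := by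
    rw [← integral_finsetSum _ (fun i _ => hint i)]
    refine integral_congr_ae (Eventually.of_forall fun ξ => ?_)
    dsimp only
    rw [← b.sum_inner_mul_inner (gradient ψ ξ) (gradient φ ξ)]
    refine Finset.sum_congr rfl fun i _ => ?_
    rw [← real_inner_comm (b i) (gradient φ ξ), gradient, gradient,
      InnerProductSpace.toDual_symm_apply, InnerProductSpace.toDual_symm_apply, mul_comm]
  have hkey : ∫ ξ, φ ξ * Δ ψ ξ = ∫ ξ, φ ξ * w ξ := by
    have e : ∫ ξ, φ ξ * w ξ = ∫ η, w η * φ η := integral_congr_ae (Eventually.of_forall fun ξ => mul_comm _ _)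
    rw [e]
    linarith [hG, hsum, hW]
  simpa only [smul_eq_mul] using hkey

end Potential

/-! ### The registered sub-stub -/

/-- **Sub-stub `stub_oddSymmetrizerBoundsToolsA` of crux stmt-NavierStokesRegularity-17973, line
`Sketch` (tools for `stub_oddSymmetrizerBounds`).** For a `C²` compactly supported planar density
`w` and its logarithmic potential `ψ = N ∗ w`: `ψ ∈ C²`, `Δψ = w`, `K ∗ w = (∇ψ)^⊥`, `ψ` is odd
when `w` is odd, and `|ψ|, ‖Dψ‖, ‖D²ψ‖ ≤ C (1 + ‖x‖)`. [folklore] -/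
theorem stub_oddSymmetrizerBoundsToolsA :
    ∀ (w ψ : EuclideanSpace ℝ (Fin 2) → ℝ), ContDiff ℝ 2 w → HasCompactSupport w →
    (∀ x, ψ x = ∫ y, (2 * Real.pi)⁻¹ * Real.log ‖x - y‖ * w y) →
    ContDiff ℝ 2 ψ ∧ (∀ x, Δ ψ x = w x) ∧ (∀ x, biotSavart2D w x = perp (gradient ψ x)) ∧
    ((∀ x, w (-x) = -w x) → ∀ x, ψ (-x) = -ψ x) ∧
    ∃ C : ℝ, 0 ≤ C ∧ ∀ x, |ψ x| ≤ C * (1 + ‖x‖) ∧ ‖fderiv ℝ ψ x‖ ≤ C * (1 + ‖x‖) ∧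
      ‖fderiv ℝ (fderiv ℝ ψ) x‖ ≤ C * (1 + ‖x‖) :=
  fun _ _ hw hwc hψ => ⟨(oddSym_psi_contDiff_two hw hwc hψ).1, oddSym_laplacian_psi hw hwc hψ,
    oddSym_biotSavart2D_eq_perp_gradient hw hwc hψ, fun hodd => oddSym_psi_odd hψ hodd,
    oddSym_psi_bounds hw hwc hψ⟩

end Summit.NavierStokesRegularity.NavierStokesRegularity.Theorems
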